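import Summits.HodgeConjecture.HodgeConjecture.Theorems.F0P3cStCharTSShellOrbitalGValue      -- ★ p850100 (LH2-p03 (g3)) «PSI-SHELL-VALUE»: `exists_normalizedOrbitalIntegral_indicator_shell_eq_twoCoset`; brings ★ p849606
import Summits.HodgeConjecture.HodgeConjecture.Theorems.F0P3cStCharTSTransferChecklist      -- ★ p849876 (LH6-p04 (g3)): the `hOG` binder this file serves (brings `isUnit_finGammaTwo`, `endoEmbLocal`, `IsLocalGRegular`)
import HarnessLib

/-!
# F0 · P3c · line LH6 «StCharTS» — road (D) «DEEP-FL», brick «HOG-OF-GVALUE★»: the `hOG` hypothesis of ★ `isLocalDeltaTransfer_doubleCosetSum_of_checklist` for the shell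
# indicator `f = 𝟙_{K_n b K_n}`, with EXPLICIT `κ_G`, `κ = 1`, `B₁ = b·C`, `B₂ = ʷb·C`, from ★ «PSI-SHELL-VALUE»

Cell `pub/hodgecm-mathlib`, crux H413 = `stmt-HodgeConjecture-24833` (lane `--supports … --as helper`), route HCCMUnconditional; hand F0P3-p01 (g20) on the road-(D)
owner's deal (LH6-p04 (g3), 2026-09-02 07:19Z «TAKE HOG-OF-GVALUE★»).  THEOREMS ONLY, sorry-free, ★-only imports; no definition ∕ instance ∕ notation ∕ named fact.
HONEST LABEL: HC_CM is proved only modulo the 7 printed citations (2 remaining: hLiu418 = stmt-HodgeConjecture-24832, h413 = stmt-HodgeConjecture-24833) until rung 0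
closes; count-neutral plumbing for the (D-c) head «XIG-ASSEMBLY».

THE MATHEMATICS ([Rogawski1990, §4.9 (4.9.4) p. 56; §12.7 L. 12.7.3 (proof) p. 195]).  ★ p850100 produces `Ψ ∈ C_c^∞(T₃)` with (i) `Ψ(t) = δ(t)·J₃(t,d)⁻¹·O_{⟦e₁t⟧}(𝟙_{K_nbK_n})` at EVERY
`t` and diagonal writing `d` off the walls, and (ii) `Ψ = κ_G·(𝟙_{b·C} + 1·𝟙_{ʷb·C})`, `κ_G = (ν(K_n)·#R·δ(b))·μ_T(T ∩ K_v) ∕ μ_T(C)`, `C = K_n ∩ T₃`.  Since `δ(t) ≠ 0` (a unit) and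
`J₃ ≠ 0` (★ `distribHaarChar_pos`, ★ `HeisRing.skewModulus_pos`), solving (i) for the orbital integral and substituting (ii) gives, along the `hlevi` stratum
`t = ι_v(γ_H)` with its frame `(d′₀, γ₂, d′₁)`, EXACTLY the `hOG` binder of ★ p849876: `O_{⟦e₁t⟧}(𝟙_{K_nbK_n}) = J₃(t) · δ(t)⁻¹ · (κ_G · (𝟙_{B₁}(t) + 1·𝟙_{B₂}(t)))` with
`B₁ = {t | b⁻¹t ∈ C}` (the anti-oriented ray, cf. ★ HORIENT) and `B₂ = {t | (ʷb)⁻¹t ∈ C}` (the oriented shell, cf. ★ COSET-COVER).  §2 records the two spelling bridges the head uses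
against ★ XIG-DATA: `{t | b′⁻¹ t ∈ C} = b′ • C` and `K.subgroupOf T = K.comap T.subtype`.

* §1 **`hOG_indicator_shell`** — the `hOG` binder VERBATIM (`f := 𝟙_{K_n b K_n}`, `κG := κ_G` explicit, `κ := 1`, `B₁`, `B₂` explicit), from ★ p850100's inputs passed through;
* §2 `setOf_inv_mul_mem_eq_smul` (any group), `subgroupOf_eq_comap_subtype` (`rfl`).

## References
* [Rogawski1990] J. D. Rogawski, *Automorphic Representations of Unitary Groups in Three Variables*, Ann. of Math. Stud. 123 (1990): §4.9 Lemma 4.9.2, (4.9.4) p. 56; §12.7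
  Lemma 12.7.3 (proof) p. 195.
* [vanDijk1972] G. van Dijk, *Computation of certain induced characters of p-adic groups*, Math. Ann. 199 (1972), Thm. p. 237.
-/

set_option autoImplicit false
-- the mandated namespace has the single-problem summit's repeated segment (`HodgeConjecture.HodgeConjecture`)
set_option linter.dupNamespace false

noncomputable section

open NumberField IsDedekindDomain MeasureTheory Topology Filter Subgroup
open scoped Matrix MatrixGroups NNReal Pointwise
open Literature.MeasureTheory.Group Literature.NumberTheory Literature.NumberTheory.Automorphic Literature.NumberTheory.Automorphic.UnitaryGroup
open Literature.NumberTheory.Rogawski1990 Literature.NumberTheory.GaloisRepresentations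
open Summit.HodgeConjecture.HodgeConjecture.Cruxes.H413.F0P3cStCharTSShellOrbitalG

namespace Summit.HodgeConjecture.HodgeConjecture.Cruxes.H413.F0P3cStCharTSHogOfGValue

variable (L : Type) [Field L] [NumberField L] [IsCMField L]

/-! ## §1 The `hOG` binder of ★ p849876 for the shell indicator -/

open scoped Classical in
set_option maxHeartbeats 3200000 in  -- statement-level `whnf` on the CM carriers and the modulus tokens (as ★ p850100 ∕ ★ p849876)
set_option synthInstance.maxHeartbeats 400000 in
/-- **«HOG-OF-GVALUE★» — the `hOG` hypothesis of ★ `F0P3cStCharTSTransferChecklist.isLocalDeltaTransfer_doubleCosetSum_of_checklist` VERBATIM** for `f := 𝟙_{K_n b K_n}`, with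
`κG := ((ν_G∘e₁⁻¹)(K_n)·#R·δ_B^{1∕2}(b))·μ_T{t ∈ K_v} ∕ μ_T(C)`, `κ := 1`, `B₁ := {t | b⁻¹t ∈ C}`, `B₂ := {t | (w₀bw₀⁻¹)⁻¹t ∈ C}`, `C := K_n.comap (T₃ ↪ U)` (the letters of ★ p850100),
under ★ p850100's hypotheses passed through (`hns w hw νG hmG μT 𝓘 n hKo hKc hr hKr w₀ hw₀ hKw hbM hbN hbNbar hbexh hR hdb hb01 hb12`).
[cite: Rogawski1990, §4.9 Lemma 4.9.2, (4.9.4) p. 56; §12.7 L. 12.7.3 (proof) p. 195] [cite: vanDijk1972, Thm. p. 237] -/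
theorem hOG_indicator_shell
    {v : HeightOneSpectrum (𝓞 ↥(maximalRealSubfield L))} (hns : ∀ w : PlacesOver L v, IsCMField.complexConj L • w.1 = w.1)
    (w : PlacesOver L v) (hw : IsCMField.complexConj L • w.1 = w.1)
    [MeasurableSpace ((cmDatum L 3 (qsForm L)).Local v)] [BorelSpace ((cmDatum L 3 (qsForm L)).Local v)]
    [∀ γ : ((cmDatum L 3 (qsForm L)).Local v), MeasurableSpace (((cmDatum L 3 (qsForm L)).Local v) ⧸ Subgroup.centralizer ({γ} : Set ((cmDatum L 3 (qsForm L)).Local v)))]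
    [∀ γ : ((cmDatum L 3 (qsForm L)).Local v), BorelSpace (((cmDatum L 3 (qsForm L)).Local v) ⧸ Subgroup.centralizer ({γ} : Set ((cmDatum L 3 (qsForm L)).Local v)))]
    (νG : Measure ((cmDatum L 3 (qsForm L)).Local v)) [νG.IsHaarMeasure] [νG.IsMulRightInvariant]
    {mG : OrbitalMeasureFamily ((cmDatum L 3 (qsForm L)).Local v)}
    (hmG : mG.IsCanonical (fun γ => IsRegularElt (γ.val : GL (Fin 3) (LocalRing L v))) νG)
    [MeasurableSpace ↥(unitaryGroupOfForm (conjLocal L (IsCMField.complexConj L) v) (cmLocalForm L 3 v))] [BorelSpace ↥(unitaryGroupOfForm (conjLocal L (IsCMField.complexConj L) v) (cmLocalForm L 3 v))]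
    (μT : Measure ↥(cmBorelTriple L 3 v).M) [μT.IsHaarMeasure]
    (𝓘 : (cmBorelTriple L 3 v).IwahoriDatum) (n : ℕ)
    (hKo : IsOpen ((𝓘.K n) : Set ↥(unitaryGroupOfForm (conjLocal L (IsCMField.complexConj L) v) (cmLocalForm L 3 v)))) (hKc : IsCompact ((𝓘.K n) : Set ↥(unitaryGroupOfForm (conjLocal L (IsCMField.complexConj L) v) (cmLocalForm L 3 v)))) {r : WithZero (Multiplicative ℤ)} (hr : r < 1)
    (hKr : ∀ k ∈ (𝓘.K n), ∀ i j : Fin 3, Valued.v ((((k : GL (Fin 3) (LocalRing L v)).val i j - (1 : Matrix (Fin 3) (Fin 3) (LocalRing L v)) i j) : LocalRing L v) w) ≤ r)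
    (w₀ : ↥(unitaryGroupOfForm (conjLocal L (IsCMField.complexConj L) v) (cmLocalForm L 3 v))) (hw₀ : Units.val (w₀ : GL (Fin 3) (LocalRing L v)) = cmLocalForm L 3 v) (hKw : ∀ κ ∈ 𝓘.K n, w₀ * κ * w₀⁻¹ ∈ 𝓘.K n)
    {b : ↥(unitaryGroupOfForm (conjLocal L (IsCMField.complexConj L) v) (cmLocalForm L 3 v))} (hbM : b ∈ (cmBorelTriple L 3 v).M)
    (hbN : ∀ x ∈ 𝓘.K n ⊓ (cmBorelTriple L 3 v).N, b * x * b⁻¹ ∈ 𝓘.K n)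
    (hbNbar : ∀ x ∈ 𝓘.K n ⊓ 𝓘.Nbar, b⁻¹ * x * b ∈ 𝓘.K n ⊓ 𝓘.Nbar)
    (hbexh : ∀ x ∈ (cmBorelTriple L 3 v).N, ∃ m : ℕ, ∀ m', m ≤ m' → b ^ m' * x * (b ^ m')⁻¹ ∈ 𝓘.K n)
    {R : Finset ↥(unitaryGroupOfForm (conjLocal L (IsCMField.complexConj L) v) (cmLocalForm L 3 v))}
    (hR : IsLeftTransversal (𝓘.K n) (𝓘.K n ⊓ ConjAct.toConjAct b • 𝓘.K n) R)
    {db : Fin 3 → (LocalRing L v)ˣ} (hdb : glDiagonal 3 (LocalRing L v) db = (b : GL (Fin 3) (LocalRing L v)))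
    (hb01 : Valued.v ((((db 0 : (LocalRing L v)ˣ) : LocalRing L v) : LocalRing L v) w) < Valued.v ((((db 1 : (LocalRing L v)ˣ) : LocalRing L v) : LocalRing L v) w))
    (hb12 : Valued.v ((((db 1 : (LocalRing L v)ˣ) : LocalRing L v) : LocalRing L v) w) < Valued.v ((((db 2 : (LocalRing L v)ˣ) : LocalRing L v) : LocalRing L v) w)) :
    ∀ (γH : ((cmDatum L 2 (Matrix.of fun i j : Fin 2 => if i.val + j.val + 1 = 2 then (1 : L) else 0)).Local v × (cmDatum L 1 (Matrix.of fun i j : Fin 1 => if i.val + j.val + 1 = 1 then (1 : L) else 0)).Local v))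
      (d' : Fin 2 → (LocalRing L v)ˣ), glDiagonal 2 (LocalRing L v) d' = ((γH.1).val : GL (Fin 2) (LocalRing L v)) → IsLocalGRegular L v γH →
      Valued.v (((d' 1 : (LocalRing L v)ˣ) : LocalRing L v) w) < Valued.v (((d' 0 : (LocalRing L v)ˣ) : LocalRing L v) w) →
      galAdicCompletionMap (L := L) (IsCMField.complexConj L) hw (((d' 0 : (LocalRing L v)ˣ) : LocalRing L v) w) * ((d' 1 : (LocalRing L v)ˣ) : LocalRing L v) w = 1 →
      ∀ (t : ↥(cmBorelTriple L 3 v).M), (t : ↥(unitaryGroupOfForm (conjLocal L (IsCMField.complexConj L) v) (cmLocalForm L 3 v))) = endoEmbLocal L v γH →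
      ∀ (hd : glDiagonal 3 (UnitaryGroup.LocalRing L v) ![d' 0, (isUnit_finGammaTwo L v γH).unit, d' 1] =
          ((t : ↥(unitaryGroupOfForm (conjLocal L (IsCMField.complexConj L) v) (cmLocalForm L 3 v))) : GL (Fin 3) (UnitaryGroup.LocalRing L v)))
        (ha : IsUnit ((((![d' 0, (isUnit_finGammaTwo L v γH).unit, d' 1] 0)⁻¹ * ![d' 0, (isUnit_finGammaTwo L v γH).unit, d' 1] 1 : (UnitaryGroup.LocalRing L v)ˣ) : (UnitaryGroup.LocalRing L v)) - 1))
        (hb' : IsUnit ((((![d' 0, (isUnit_finGammaTwo L v γH).unit, d' 1] 0)⁻¹ * ![d' 0, (isUnit_finGammaTwo L v γH).unit, d' 1] 2 : (UnitaryGroup.LocalRing L v)ˣ) : (UnitaryGroup.LocalRing L v)) - 1)),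
      haveI := locallyCompactSpace_cmBorelU L 3 v
      classOrbitalIntegral mG ((DoubleCoset.doubleCoset b ((𝓘.K n) : Set ↥(unitaryGroupOfForm (conjLocal L (IsCMField.complexConj L) v) (cmLocalForm L 3 v))) ((𝓘.K n) : Set ↥(unitaryGroupOfForm (conjLocal L (IsCMField.complexConj L) v) (cmLocalForm L 3 v)))).indicator fun _ => (1 : ℂ))
          (ConjClasses.mk (cmDatumLocalCongr L v (1 : GL (Fin 3) (UnitaryGroup.LocalRing L v)) isUnit_one (F0P3cStCharTSDeltaAtLevi.formCongr_one_qsForm L v)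
            (t : ↥(unitaryGroupOfForm (conjLocal L (IsCMField.complexConj L) v) (cmLocalForm L 3 v))))) =
        (((letI : MeasurableSpace (UnitaryGroup.LocalRing L v) := borel _; haveI : BorelSpace (UnitaryGroup.LocalRing L v) := ⟨rfl⟩
            haveI : SecondCountableTopology (UnitaryGroup.LocalRing L v) := secondCountableTopology_localRing (E := L) v
            ((distribHaarChar (UnitaryGroup.LocalRing L v) ha.unit)⁻¹ *
              (HeisRing.skewModulus (conjLocal L (IsCMField.complexConj L) v) (continuous_conjLocal L (IsCMField.complexConj L) v) hb'.unit
                (HeisRing.map_unit_torusCentralScalar_sub_one (conjLocal L (IsCMField.complexConj L) v) (cmLocalForm_eq_over L 3 v) t hd hb'))⁻¹ :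
                  ℝ≥0)) : ℝ) : ℂ) *
          ((rootDeltaChar (cmBorelTriple L 3 v).P
              ⟨(t : ↥(unitaryGroupOfForm (conjLocal L (IsCMField.complexConj L) v) (cmLocalForm L 3 v))), (cmBorelTriple L 3 v).M_le t.2⟩ : ℂˣ) : ℂ)⁻¹ *
          (((((((νG.map (cmDatumLocalCongr L v (1 : GL (Fin 3) (LocalRing L v)) isUnit_one (F0P3cStCharTSDeltaAtLevi.formCongr_one_qsForm L v)).symm : Measure ↥(unitaryGroupOfForm (conjLocal L (IsCMField.complexConj L) v) (cmLocalForm L 3 v))))).real ((𝓘.K n) : Set ↥(unitaryGroupOfForm (conjLocal L (IsCMField.complexConj L) v) (cmLocalForm L 3 v))) : ℂ) * (R.card : ℂ) * ((rootDeltaChar (cmBorelTriple L 3 v).P (Subgroup.inclusion (cmBorelTriple L 3 v).M_le (⟨b, hbM⟩ : ↥(cmBorelTriple L 3 v).M)) : ℂˣ) : ℂ)) * ((μT.real {t : ↥(cmBorelTriple L 3 v).M | (t : ↥(unitaryGroupOfForm (conjLocal L (IsCMField.complexConj L) v) (cmLocalForm L 3 v))) ∈ cmLocalIntegralLevel L 3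 (Matrix.of fun i j : Fin 3 => if i.val + j.val + 1 = 3 then (1 : L) else 0) v} : ℝ) : ℂ)) / ((μT.real ((((𝓘.K n)).comap (cmBorelTriple L 3 v).M.subtype) : Set ↥(cmBorelTriple L 3 v).M) : ℝ) : ℂ) *
            ({t : ↥(cmBorelTriple L 3 v).M | ((⟨b, hbM⟩ : ↥(cmBorelTriple L 3 v).M))⁻¹ * t ∈ ((((𝓘.K n)).comap (cmBorelTriple L 3 v).M.subtype) : Set ↥(cmBorelTriple L 3 v).M)}.indicator (fun _ => (1 : ℂ)) t +
              1 * {t : ↥(cmBorelTriple L 3 v).M | ((⟨w₀ * b * w₀⁻¹, weylConj_mem_cmTorus L v w₀ hw₀ (⟨b, hbM⟩ : ↥(cmBorelTriple L 3 v).M)⟩ : ↥(cmBorelTriple L 3 v).M))⁻¹ * t ∈ ((((𝓘.K n)).comap (cmBorelTriple L 3 v).M.subtype) : Set ↥(cmBorelTriple L 3 v).M)}.indicator (fun _ => (1 : ℂ)) t)) := by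
  intro γH d' _hd' _hreg _hlt _h01 t _ht hd ha hb'
  haveI := locallyCompactSpace_cmBorelU L 3 v
  obtain ⟨Ψ, -, -, hcl, hval⟩ := exists_normalizedOrbitalIntegral_indicator_shell_eq_twoCoset L hns w hw νG hmG μT 𝓘 n hKo hKc hr hKr w₀ hw₀ hKw hbM
    hbN hbNbar hbexh hR hdb hb01 hb12
  have hΨt := hcl t ![d' 0, (isUnit_finGammaTwo L v γH).unit, d' 1] hd ha hb'
  have hvt := congrFun hval t
  dsimp only at hvt
  -- `δ(t) ≠ 0` and `J₃(t) ≠ 0`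
  have hDEL : ((rootDeltaChar (cmBorelTriple L 3 v).P
      ⟨(t : ↥(unitaryGroupOfForm (conjLocal L (IsCMField.complexConj L) v) (cmLocalForm L 3 v))), (cmBorelTriple L 3 v).M_le t.2⟩ : ℂˣ) : ℂ) ≠ 0 :=
    (rootDeltaChar (cmBorelTriple L 3 v).P ⟨(t : ↥(unitaryGroupOfForm (conjLocal L (IsCMField.complexConj L) v) (cmLocalForm L 3 v))), (cmBorelTriple L 3 v).M_le t.2⟩).ne_zero
  have hJJ : (((letI : MeasurableSpace (UnitaryGroup.LocalRing L v) := borel _; haveI : BorelSpace (UnitaryGroup.LocalRing L v) := ⟨rfl⟩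
      haveI : SecondCountableTopology (UnitaryGroup.LocalRing L v) := secondCountableTopology_localRing (E := L) v
      ((distribHaarChar (UnitaryGroup.LocalRing L v) ha.unit)⁻¹ *
        (HeisRing.skewModulus (conjLocal L (IsCMField.complexConj L) v) (continuous_conjLocal L (IsCMField.complexConj L) v) hb'.unit
          (HeisRing.map_unit_torusCentralScalar_sub_one (conjLocal L (IsCMField.complexConj L) v) (cmLocalForm_eq_over L 3 v) t hd hb'))⁻¹ : ℝ≥0)) : ℝ) : ℂ) ≠ 0 := by
    letI : MeasurableSpace (UnitaryGroup.LocalRing L v) := borel _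
    haveI : BorelSpace (UnitaryGroup.LocalRing L v) := ⟨rfl⟩
    haveI : SecondCountableTopology (UnitaryGroup.LocalRing L v) := secondCountableTopology_localRing (E := L) v
    exact Complex.ofReal_ne_zero.2 (NNReal.coe_ne_zero.2
      (mul_ne_zero (inv_ne_zero distribHaarChar_pos.ne') (inv_ne_zero (HeisRing.skewModulus_pos _ _ _ _).ne')))
  have key : ∀ (D J O X : ℂ), D ≠ 0 → J ≠ 0 → D * J⁻¹ * O = X → O = J * D⁻¹ * X := by
    intro D J O X hD hJ h
    rw [← h]
    field_simp
  exact key _ _ _ _ hDEL hJJ (hΨt.symm.trans hvt)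

/-! ## §2 Spelling bridges for the head (against ★ XIG-DATA ∕ ★ COSET-COVER) -/

/-- `{t | b′⁻¹ t ∈ C} = b′ • C` in any group (the oriented∕anti-oriented shell as a left translate). [cite: Rogawski1990, §12.7 L. 12.7.3 (proof) p. 195] -/
theorem setOf_inv_mul_mem_eq_smul {G : Type*} [Group G] (b' : G) (C : Set G) : {t : G | b'⁻¹ * t ∈ C} = b' • C := by
  ext t
  rw [Set.mem_setOf_eq, Set.mem_smul_set_iff_inv_smul_mem, smul_eq_mul]

/-- `K.subgroupOf T = K.comap T.subtype` (Mathlib's definition; recorded for the head's rewriting between ★ XIG-DATA's and ★ p850100's spellings of `C = K_n ∩ T₃`). [folklore] -/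
theorem subgroupOf_eq_comap_subtype {G : Type*} [Group G] (K T : Subgroup G) : K.subgroupOf T = K.comap T.subtype := rfl

end Summit.HodgeConjecture.HodgeConjecture.Cruxes.H413.F0P3cStCharTSHogOfGValue

end
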